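import Summits.CriticalPhenomena.PercolationContinuityZ3.Theorems.PercNearOneGluingNoHeavyLowerTailAntitheticTopVertex
import HarnessLib

/-!
# `NoHeavyLowerTail` (stmt-CriticalPhenomena-4575) — antithetic cluster pairs: **THE TOP EVENT AT A TWIN OF THE SOURCE**
# (prim-hp-2 gen 73, HOME/MEMO-gen73.md §1, HOME/THEOREM-TW.md)

Support file (`--supports stmt-CriticalPhenomena-4575`, hull-port prover `prim-hp-2`, gen 73).  No definitions, no named facts, no sorries;
standard axioms.  VERTEX version; notation of …AntitheticBoxes / …AntitheticTopVertex: colourings `T ⊆ Sym2 V` (red pairs), edge set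
`E`, source `s`, `X T = openCluster (T ∩ E) s` (red cluster), `Y T = openCluster (Tᶜ ∩ E) s` (blue cluster); `K`-form = super-odd
twisted-monotone test kernels `K₁, K₂` (contains the shifted class `F⁺(X) − F⁻(Y)`, `F⁻ ≤ F⁺` monotone, and the odd class).

`P` is a TWIN of the source `s` if `s ≠ P` and `N(s) ∖ {P} = N(P) ∖ {s}` (`htwin`).  The TOP EVENT at `P` is `{P ∈ X T, P ∉ Y T}`.
On it no common neighbour `v` is joined to `s` and to `P` by two blue pairs.  Split it by whether some common neighbour `v` carries two
RED pairs `sv, Pv`: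
* `Antithetic.Twin.top_rr_sum_nonneg` — **the red–red part is nonnegative on EVERY twin pair** (`K`-form): the event
  `{no common neighbour blue–blue, some common neighbour red–red}` is partitioned by the colours of the pairs at `s` and `P` into
  RED-DOMINATED BOXES (for members `T, T'` opposite off those pairs every blue path of `T'` from `s` starts with a blue pair `sj`, and then
  `Pj` is red while `P ∈ X T` through the red–red neighbour; all later pairs are red in `T`), so `Antithetic.Box.freeze_boxes_sum_nonneg`
  with `L = {P}` applies.
* `Antithetic.Twin.nested_of_noRR` — under the hypothesis **(TA)**: every vertex outside `N(s) ∪ {s, P}` is adjacent to every common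
  neighbour (`hTA`), the complementary part `{top event, no red–red common neighbour}` has NESTED tops `Y T ⊆ X T` (if a vertex `w` of
  `Y T` outside `N(s) ∪ {s, P}` had only blue pairs towards `N(s)`, then either `P ∈ Y T` through a blue `Pk`, or every pair at `s` is blue
  and `P ∉ X T`), hence is termwise nonnegative.
* `Antithetic.Twin.top_sum_nonneg`, `Antithetic.Twin.vertex_sum_nonneg` — **THEOREM TA**: for twins `s, P` (`sP ∉ E`) satisfying (TA),
  the top sum at `P` is nonnegative in `K`-form, hence (…AntitheticTopVertex) the |R| = 1 VERTEX ANTITHETIC INEQUALITY holds at `P`: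
  `0 ≤ Σ_{T : ¬(P ∈ X T ∧ P ∈ Y T)} (F(X T) − F(Y T))·(G(X T) − G(Y T))` for all monotone `F, G`.
  Instances: the two apexes of the suspension (double cone) of ANY finite graph — `K_{2,k}` with anything inside the middle, the octahedron at
  the antipode (…AntitheticOctaTopVertex was a kernel certificate) —, every complete bipartite graph `K_{m,n}` at a vertex on the side of
  the source (`K_{3,3}`: …AntitheticK33TopVertex was a certificate; `K_{3,k}` for all `k`), every COMPLETE MULTIPARTITE graph at a vertex of
  the source's part, and every join `\bar K_m * H`.
[cite: VandenbergHaggstromKahn2005, §1 p. 6 ("Harris' inequality"), §1 p. 3 (open cluster `C_s`)]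
-/

noncomputable section

namespace Summit.CriticalPhenomena.PercolationContinuityZ3.Theorems

open Literature.Probability.Percolation
open scoped Classical

namespace Antithetic

namespace Twin

variable {V : Type*}

section Clusters

variable {E : Set (Sym2 V)} {s P : V}

/-- A red pair `uw` of `E` with `u` in the red cluster puts `w` in the red cluster. [folklore] -/
theorem mem_red_of_pair {T : Set (Sym2 V)} {u w : V} (hu : u ∈ openCluster (T ∩ E) s) (hT : s(u, w) ∈ T)
    (hE : s(u, w) ∈ E) (huw : u ≠ w) : w ∈ openCluster (T ∩ E) s :=
  TwoStage.Cone.mem_cluster_of_adj hu ((openGraph_adj _ u w).2 ⟨⟨hT, hE⟩, huw⟩)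

/-- A blue pair `uw` of `E` with `u` in the blue cluster puts `w` in the blue cluster. [folklore] -/
theorem mem_blue_of_pair {T : Set (Sym2 V)} {u w : V} (hu : u ∈ openCluster (Tᶜ ∩ E) s) (hT : s(u, w) ∉ T)
    (hE : s(u, w) ∈ E) (huw : u ≠ w) : w ∈ openCluster (Tᶜ ∩ E) s :=
  TwoStage.Cone.mem_cluster_of_adj hu ((openGraph_adj _ u w).2 ⟨⟨hT, hE⟩, huw⟩)

/-- Twins: a red–red common neighbour `v` puts `P` into the red cluster of `s`. [this work] -/
theorem mem_red_of_rr (htwin : ∀ v, v ≠ s → v ≠ P → (s(s, v) ∈ E ↔ s(P, v) ∈ E)) {T : Set (Sym2 V)} {v : V}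
    (hvs : v ≠ s) (hvP : v ≠ P) (hvE : s(s, v) ∈ E) (hsv : s(s, v) ∈ T) (hPv : s(P, v) ∈ T) :
    P ∈ openCluster (T ∩ E) s := by
  have hv : v ∈ openCluster (T ∩ E) s := mem_red_of_pair (mem_openCluster_self _ s) hsv hvE hvs.symm
  have hPvE : s(P, v) ∈ E := (htwin v hvs hvP).1 hvE
  exact mem_red_of_pair hv (by rw [Sym2.eq_swap]; exact hPv) (by rw [Sym2.eq_swap]; exact hPvE) hvP

/-- Twins: on the top event no common neighbour is blue–blue. [this work] -/
theorem noBB_of_top (htwin : ∀ v, v ≠ s → v ≠ P → (s(s, v) ∈ E ↔ s(P, v) ∈ E)) {T : Set (Sym2 V)}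
    (hPY : P ∉ openCluster (Tᶜ ∩ E) s) {v : V} (hvs : v ≠ s) (hvP : v ≠ P) (hvE : s(s, v) ∈ E) :
    s(s, v) ∈ T ∨ s(P, v) ∈ T := by
  by_contra h
  have h1 : s(s, v) ∉ T := fun h' => h (Or.inl h')
  have h2 : s(P, v) ∉ T := fun h' => h (Or.inr h')
  have hv : v ∈ openCluster (Tᶜ ∩ E) s := mem_blue_of_pair (mem_openCluster_self _ s) h1 hvE hvs.symm
  have hPvE : s(P, v) ∈ E := (htwin v hvs hvP).1 hvE
  exact hPY (mem_blue_of_pair hv (by rw [Sym2.eq_swap]; exact h2) (by rw [Sym2.eq_swap]; exact hPvE) hvP)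

/-- Twins: on the top event every common neighbour lies in the red cluster. [this work] -/
theorem nbr_mem_red_of_top (htwin : ∀ v, v ≠ s → v ≠ P → (s(s, v) ∈ E ↔ s(P, v) ∈ E)) {T : Set (Sym2 V)}
    (hPX : P ∈ openCluster (T ∩ E) s) (hPY : P ∉ openCluster (Tᶜ ∩ E) s) {v : V} (hvs : v ≠ s) (hvP : v ≠ P)
    (hvE : s(s, v) ∈ E) : v ∈ openCluster (T ∩ E) s := by
  rcases noBB_of_top htwin hPY hvs hvP hvE with h | h
  · exact mem_red_of_pair (mem_openCluster_self _ s) h hvE hvs.symm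
  · exact mem_red_of_pair hPX h ((htwin v hvs hvP).1 hvE) hvP.symm

/-- **Red domination of the type boxes.**  Twins `s, P`; `T, T'` two colourings with the same colours on the pairs at `s` and at `P` and
opposite colours elsewhere; in `T` some common neighbour is red–red and none is blue–blue.  Then `Y T' ⊆ X T`. [this work] -/
theorem dom_of_types (htwin : ∀ v, v ≠ s → v ≠ P → (s(s, v) ∈ E ↔ s(P, v) ∈ E)) {T T' : Set (Sym2 V)}
    (hagree : ∀ e : Sym2 V, (s ∈ e ∨ P ∈ e) → (e ∈ T' ↔ e ∈ T))
    (hflip : ∀ e : Sym2 V, ¬ (s ∈ e ∨ P ∈ e) → (e ∈ T' ↔ e ∉ T))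
    (hPX : P ∈ openCluster (T ∩ E) s)
    (hnoBB : ∀ v, v ≠ s → v ≠ P → s(s, v) ∈ E → s(s, v) ∈ T ∨ s(P, v) ∈ T) :
    openCluster (T'ᶜ ∩ E) s ⊆ openCluster (T ∩ E) s := by
  refine TwoStage.Fan.cluster_subset_of_closed (mem_openCluster_self _ s) fun u w hu huw => ?_
  obtain ⟨⟨hT', hE⟩, hne⟩ := (openGraph_adj _ u w).1 huw
  by_cases hA : s ∈ s(u, w) ∨ P ∈ s(u, w)
  · -- a pair at `s` or at `P`: blue in `T` as well
    have hTb : s(u, w) ∉ T := fun h => hT' ((hagree _ hA).2 h)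
    by_cases hws : w = s
    · rw [hws]; exact mem_openCluster_self _ s
    by_cases hwP : w = P
    · rw [hwP]; exact hPX
    rcases hA with hA | hA
    · -- `u = s`: `w` is a common neighbour, `Pw` is red
      have hus : u = s := by
        rcases Sym2.mem_iff.1 hA with h | h
        · exact h.symm
        · exact absurd h.symm hws
      subst hus
      rcases hnoBB w hws hwP hE with h | h
      · exact absurd h hTb
      · exact mem_red_of_pair hPX h ((htwin w hws hwP).1 hE) (Ne.symm hwP)
    · -- `u = P`: `w` is a common neighbour, `sw` is red
      have huP : u = P := by
        rcases Sym2.mem_iff.1 hA with h | h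
        · exact h.symm
        · exact absurd h.symm hwP
      subst huP
      have hswE : s(s, w) ∈ E := (htwin w hws hwP).2 hE
      rcases hnoBB w hws hwP hswE with h | h
      · exact mem_red_of_pair (mem_openCluster_self _ s) h hswE (Ne.symm hws)
      · exact absurd h hTb
  · -- a free pair: blue in `T'` means red in `T`
    have hTr : s(u, w) ∈ T := by
      by_contra h
      exact hT' ((hflip _ hA).2 h)
    exact mem_red_of_pair hu hTr hE hne

end Clusters

variable [Fintype V]

/-- **The red–red part of the top event at a twin is nonnegative (every twin pair, `K`-form).**  `s ≠ P` twins (`htwin`).  Then for all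
super-odd twisted-monotone `K₁, K₂`:
`0 ≤ Σ_{T : P ∈ X T, P ∉ Y T, ∃ common neighbour v with sv, Pv red} K₁(X T, Y T)·K₂(X T, Y T)`. [this work] -/
theorem top_rr_sum_nonneg (E : Set (Sym2 V)) (s P : V) (htwin : ∀ v, v ≠ s → v ≠ P → (s(s, v) ∈ E ↔ s(P, v) ∈ E))
    {K₁ K₂ : Set V → Set V → ℝ}
    (hK₁ : ∀ ⦃A A' B B' : Set V⦄, A ⊆ A' → B' ⊆ B → K₁ A B ≤ K₁ A' B') (hso₁ : ∀ A B, 0 ≤ K₁ A B + K₁ B A)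
    (hK₂ : ∀ ⦃A A' B B' : Set V⦄, A ⊆ A' → B' ⊆ B → K₂ A B ≤ K₂ A' B') (hso₂ : ∀ A B, 0 ≤ K₂ A B + K₂ B A) :
    0 ≤ ∑ T ∈ Finset.univ.filter (fun T : Set (Sym2 V) => P ∈ openCluster (T ∩ E) s ∧ P ∉ openCluster (Tᶜ ∩ E) s ∧
        ∃ v, v ≠ s ∧ v ≠ P ∧ s(s, v) ∈ E ∧ s(s, v) ∈ T ∧ s(P, v) ∈ T),
      K₁ (openCluster (T ∩ E) s) (openCluster (Tᶜ ∩ E) s) * K₂ (openCluster (T ∩ E) s) (openCluster (Tᶜ ∩ E) s) := by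
  -- the pairs at `s` or `P`, and the "type" event: some common neighbour red–red, none blue–blue
  let A : Set (Sym2 V) := {e | s ∈ e ∨ P ∈ e}
  let good : Set (Sym2 V) → Prop := fun N =>
    (∃ v, v ≠ s ∧ v ≠ P ∧ s(s, v) ∈ E ∧ s(s, v) ∈ N ∧ s(P, v) ∈ N) ∧
    (∀ v, v ≠ s → v ≠ P → s(s, v) ∈ E → s(s, v) ∈ N ∨ s(P, v) ∈ N)
  have hsA : ∀ v, s(s, v) ∈ A := fun v => Or.inl (Sym2.mem_mk_left s v)
  have hPA : ∀ v, s(P, v) ∈ A := fun v => Or.inr (Sym2.mem_mk_left P v)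
  -- `good` only depends on the pairs of `A`
  have hgood_iff : ∀ N M : Set (Sym2 V), (∀ e ∈ A, (e ∈ M ↔ e ∈ N)) → (good N ↔ good M) := by
    intro N M h
    constructor
    · rintro ⟨⟨v, hvs, hvP, hvE, h1, h2⟩, hno⟩
      exact ⟨⟨v, hvs, hvP, hvE, (h _ (hsA v)).2 h1, (h _ (hPA v)).2 h2⟩,
        fun v hvs hvP hvE => (hno v hvs hvP hvE).imp (h _ (hsA v)).2 (h _ (hPA v)).2⟩
    · rintro ⟨⟨v, hvs, hvP, hvE, h1, h2⟩, hno⟩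
      exact ⟨⟨v, hvs, hvP, hvE, (h _ (hsA v)).1 h1, (h _ (hPA v)).1 h2⟩,
        fun v hvs hvP hvE => (hno v hvs hvP hvE).imp (h _ (hsA v)).1 (h _ (hPA v)).1⟩
  let C := {N : Set (Sym2 V) // N ⊆ A ∧ good N}
  let D : Finset (Set (Sym2 V)) := Finset.univ.filter fun T => good T
  have hfreeze := Box.freeze_boxes_sum_nonneg E s D (fun _ : C => A) (fun c : C => c.1)
    (fun T hT => ?_) (fun c T hT => ?_) (fun c c' T hc hc' => ?_) (fun c T T' hT hT' hflip => ?_) {P} hK₁ hso₁ hK₂ hso₂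
  · -- identify the frozen event with the red–red top event
    have hev : D.filter (fun T => ∀ Q ∈ ({P} : Set V), Q ∉ openCluster (Tᶜ ∩ E) s) =
        Finset.univ.filter (fun T : Set (Sym2 V) => P ∈ openCluster (T ∩ E) s ∧ P ∉ openCluster (Tᶜ ∩ E) s ∧
          ∃ v, v ≠ s ∧ v ≠ P ∧ s(s, v) ∈ E ∧ s(s, v) ∈ T ∧ s(P, v) ∈ T) := by
      ext T
      simp only [D, Finset.mem_filter, Finset.mem_univ, true_and, Set.mem_singleton_iff, forall_eq]
      constructor
      · rintro ⟨⟨⟨v, hvs, hvP, hvE, h1, h2⟩, -⟩, hPY⟩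
        exact ⟨mem_red_of_rr htwin hvs hvP hvE h1 h2, hPY, v, hvs, hvP, hvE, h1, h2⟩
      · rintro ⟨-, hPY, v, hvs, hvP, hvE, h1, h2⟩
        exact ⟨⟨⟨v, hvs, hvP, hvE, h1, h2⟩, fun w hws hwP hwE => noBB_of_top htwin hPY hws hwP hwE⟩, hPY⟩
    rw [← hev]
    exact hfreeze
  · -- cover: the box of `T` is indexed by `T ∩ A`
    have hgT : good T := (Finset.mem_filter.1 hT).2
    refine ⟨⟨T ∩ A, Set.inter_subset_right, (hgood_iff T (T ∩ A) fun e he => ⟨fun h => h.1, fun h => ⟨h, he⟩⟩).1 hgT⟩,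
      fun e he => ⟨fun h => ⟨h, he⟩, fun h => h.1⟩⟩
  · -- inside
    exact Finset.mem_filter.2 ⟨Finset.mem_univ _, (hgood_iff c.1 T hT).1 c.2.2⟩
  · -- uniqueness
    apply Subtype.ext
    ext e
    constructor
    · intro he
      exact (hc' e (c.2.1 he)).1 ((hc e (c.2.1 he)).2 he)
    · intro he
      exact (hc e (c'.2.1 he)).1 ((hc' e (c'.2.1 he)).2 he)
  · -- red domination of the type box
    have hgT : good T := (hgood_iff c.1 T hT).1 c.2.2
    obtain ⟨⟨v, hvs, hvP, hvE, h1, h2⟩, hnoBB⟩ := hgT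
    refine dom_of_types htwin (fun e he => ?_) (fun e he => hflip e he) (mem_red_of_rr htwin hvs hvP hvE h1 h2) hnoBB
    exact (hT' e he).trans (hT e he).symm

/-- **Nested tops on the no-red–red part, under (TA).**  Twins `s, P` with `sP ∉ E`; (TA): every vertex `w ∉ N(s) ∪ {s, P}` is adjacent to
every common neighbour.  If `P ∈ X T`, `P ∉ Y T` and no common neighbour is red–red, then `Y T ⊆ X T`. [this work] -/
theorem nested_of_noRR {E : Set (Sym2 V)} {s P : V} (hsP : s ≠ P) (hsPE : s(s, P) ∉ E)
    (htwin : ∀ v, v ≠ s → v ≠ P → (s(s, v) ∈ E ↔ s(P, v) ∈ E))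
    (hTA : ∀ w v, w ≠ s → w ≠ P → s(s, w) ∉ E → v ≠ s → v ≠ P → s(s, v) ∈ E → s(w, v) ∈ E)
    {T : Set (Sym2 V)} (hPX : P ∈ openCluster (T ∩ E) s) (hPY : P ∉ openCluster (Tᶜ ∩ E) s)
    (hnoRR : ∀ v, v ≠ s → v ≠ P → s(s, v) ∈ E → ¬ (s(s, v) ∈ T ∧ s(P, v) ∈ T)) :
    openCluster (Tᶜ ∩ E) s ⊆ openCluster (T ∩ E) s := by
  -- the blue cluster is contained in `X T ∩ Y T`, which is closed under blue pairs
  suffices h : openCluster (Tᶜ ∩ E) s ⊆ openCluster (T ∩ E) s ∩ openCluster (Tᶜ ∩ E) s from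
    fun u hu => (h hu).1
  refine TwoStage.Fan.cluster_subset_of_closed ⟨mem_openCluster_self _ s, mem_openCluster_self _ s⟩ fun u w hu huw => ?_
  obtain ⟨⟨hTb, hE⟩, hne⟩ := (openGraph_adj _ u w).1 huw
  have hwY : w ∈ openCluster (Tᶜ ∩ E) s := mem_blue_of_pair hu.2 hTb hE hne
  refine ⟨?_, hwY⟩
  by_cases hws : w = s
  · rw [hws]; exact mem_openCluster_self _ s
  have hwP : w ≠ P := fun h => hPY (h ▸ hwY)
  by_cases hwN : s(s, w) ∈ E
  · -- `w` is a common neighbour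
    exact nbr_mem_red_of_top htwin hPX hPY hws hwP hwN
  · -- `w` is an extra vertex: adjacent to every common neighbour
    by_cases hred : ∃ v, v ≠ s ∧ v ≠ P ∧ s(s, v) ∈ E ∧ s(w, v) ∈ T
    · obtain ⟨v, hvs, hvP, hvE, hwv⟩ := hred
      have hv : v ∈ openCluster (T ∩ E) s := nbr_mem_red_of_top htwin hPX hPY hvs hvP hvE
      have hvw : v ≠ w := fun h => hwN (h ▸ hvE)
      exact mem_red_of_pair hv (by rw [Sym2.eq_swap]; exact hwv) (by rw [Sym2.eq_swap]; exact hTA w v hws hwP hwN hvs hvP hvE) hvw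
    · have hred' : ∀ v, v ≠ s → v ≠ P → s(s, v) ∈ E → s(w, v) ∉ T :=
        fun v hvs hvP hvE hwv => hred ⟨v, hvs, hvP, hvE, hwv⟩
      -- every common neighbour is blue-joined to `w`, hence in `Y T`; then `Pv` is red and, by no red–red, `sv` is blue for every `v`
      exfalso
      have hblue : ∀ v, v ≠ s → v ≠ P → s(s, v) ∈ E → s(s, v) ∉ T := by
        intro v hvs hvP hvE hsv
        have hvw : w ≠ v := fun h => hwN (h ▸ hvE)
        have hvY : v ∈ openCluster (Tᶜ ∩ E) s := mem_blue_of_pair hwY (hred' v hvs hvP hvE) (hTA w v hws hwP hwN hvs hvP hvE) hvw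
        have hPvE : s(P, v) ∈ E := (htwin v hvs hvP).1 hvE
        by_cases hPv : s(P, v) ∈ T
        · exact hnoRR v hvs hvP hvE ⟨hsv, hPv⟩
        · exact hPY (mem_blue_of_pair hvY (by rw [Sym2.eq_swap]; exact hPv) (by rw [Sym2.eq_swap]; exact hPvE) hvP)
      -- then the red cluster of `s` is `{s}`, contradicting `P ∈ X T`
      have hXs : openCluster (T ∩ E) s ⊆ {s} := by
        refine TwoStage.Fan.cluster_subset_of_closed (Set.mem_singleton s) fun u x hu hux => ?_
        obtain ⟨⟨hTr, hxE⟩, hne'⟩ := (openGraph_adj _ u x).1 hux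
        rw [Set.mem_singleton_iff] at hu
        subst hu
        exfalso
        by_cases hxP : x = P
        · exact hsPE (hxP ▸ hxE)
        · exact hblue x (Ne.symm hne') hxP hxE hTr
      exact hsP (Set.mem_singleton_iff.1 (hXs hPX)).symm

/-- **THEOREM TA (top form, `K`-form).**  Twins `s ≠ P`, `sP ∉ E`, with (TA): every vertex outside `N(s) ∪ {s, P}` is adjacent to every
common neighbour.  Then the top sum at `P` is nonnegative for all super-odd twisted-monotone `K₁, K₂`:
`0 ≤ Σ_{T : P ∈ X T, P ∉ Y T} K₁(X T, Y T)·K₂(X T, Y T)`. [this work] -/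
theorem top_sum_nonneg (E : Set (Sym2 V)) (s P : V) (hsP : s ≠ P) (hsPE : s(s, P) ∉ E)
    (htwin : ∀ v, v ≠ s → v ≠ P → (s(s, v) ∈ E ↔ s(P, v) ∈ E))
    (hTA : ∀ w v, w ≠ s → w ≠ P → s(s, w) ∉ E → v ≠ s → v ≠ P → s(s, v) ∈ E → s(w, v) ∈ E)
    {K₁ K₂ : Set V → Set V → ℝ}
    (hK₁ : ∀ ⦃A A' B B' : Set V⦄, A ⊆ A' → B' ⊆ B → K₁ A B ≤ K₁ A' B') (hso₁ : ∀ A B, 0 ≤ K₁ A B + K₁ B A)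
    (hK₂ : ∀ ⦃A A' B B' : Set V⦄, A ⊆ A' → B' ⊆ B → K₂ A B ≤ K₂ A' B') (hso₂ : ∀ A B, 0 ≤ K₂ A B + K₂ B A) :
    0 ≤ ∑ T ∈ Finset.univ.filter (fun T : Set (Sym2 V) => P ∈ openCluster (T ∩ E) s ∧ P ∉ openCluster (Tᶜ ∩ E) s),
      K₁ (openCluster (T ∩ E) s) (openCluster (Tᶜ ∩ E) s) * K₂ (openCluster (T ∩ E) s) (openCluster (Tᶜ ∩ E) s) := by
  have hrr := top_rr_sum_nonneg E s P htwin hK₁ hso₁ hK₂ hso₂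
  refine hrr.trans (Finset.sum_le_sum_of_subset_of_nonneg (fun T hT => ?_) (fun T hT hT1 => ?_))
  · -- the red–red top event is part of the top event
    simp only [Finset.mem_filter, Finset.mem_univ, true_and] at hT ⊢
    exact ⟨hT.1, hT.2.1⟩
  · -- off the red–red part: nested tops, termwise
    simp only [Finset.mem_filter, Finset.mem_univ, true_and] at hT hT1
    obtain ⟨hPX, hPY⟩ := hT
    have hnoRR : ∀ v, v ≠ s → v ≠ P → s(s, v) ∈ E → ¬ (s(s, v) ∈ T ∧ s(P, v) ∈ T) :=
      fun v hvs hvP hvE h => hT1 ⟨hPX, hPY, v, hvs, hvP, hvE, h.1, h.2⟩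
    have hYX := nested_of_noRR hsP hsPE htwin hTA hPX hPY hnoRR
    have h1 : 0 ≤ K₁ (openCluster (T ∩ E) s) (openCluster (Tᶜ ∩ E) s) := by
      have ha := hso₁ (openCluster (Tᶜ ∩ E) s) (openCluster (Tᶜ ∩ E) s)
      have hb := hK₁ hYX (subset_refl (openCluster (Tᶜ ∩ E) s))
      linarith
    have h2 : 0 ≤ K₂ (openCluster (T ∩ E) s) (openCluster (Tᶜ ∩ E) s) := by
      have ha := hso₂ (openCluster (Tᶜ ∩ E) s) (openCluster (Tᶜ ∩ E) s)
      have hb := hK₂ hYX (subset_refl (openCluster (Tᶜ ∩ E) s))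
      linarith
    exact mul_nonneg h1 h2

/-- **THEOREM TA (shifted top form).**  Twins `s ≠ P`, `sP ∉ E`, (TA).  Then TOP_shift(E; P): for all monotone `F⁻ ≤ F⁺`, `G⁻ ≤ G⁺`,
`0 ≤ Σ_{T : P ∈ X T, P ∉ Y T} (F⁺(X T) − F⁻(Y T))·(G⁺(X T) − G⁻(Y T))`. [this work] -/
theorem top_shift_sum_nonneg (E : Set (Sym2 V)) (s P : V) (hsP : s ≠ P) (hsPE : s(s, P) ∉ E)
    (htwin : ∀ v, v ≠ s → v ≠ P → (s(s, v) ∈ E ↔ s(P, v) ∈ E))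
    (hTA : ∀ w v, w ≠ s → w ≠ P → s(s, w) ∉ E → v ≠ s → v ≠ P → s(s, v) ∈ E → s(w, v) ∈ E)
    (Fp Fm Gp Gm : Set V → ℝ) (hFp : Monotone Fp) (hFm : Monotone Fm) (hF : ∀ S, Fm S ≤ Fp S)
    (hGp : Monotone Gp) (hGm : Monotone Gm) (hG : ∀ S, Gm S ≤ Gp S) :
    0 ≤ ∑ T ∈ Finset.univ.filter (fun T : Set (Sym2 V) => P ∈ openCluster (T ∩ E) s ∧ P ∉ openCluster (Tᶜ ∩ E) s),
      (Fp (openCluster (T ∩ E) s) - Fm (openCluster (Tᶜ ∩ E) s)) * (Gp (openCluster (T ∩ E) s) - Gm (openCluster (Tᶜ ∩ E) s)) := by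
  have hK₁ : ∀ ⦃A A' B B' : Set V⦄, A ⊆ A' → B' ⊆ B → Fp A - Fm B ≤ Fp A' - Fm B' :=
    fun A A' B B' hA hB => sub_le_sub (hFp hA) (hFm hB)
  have hK₂ : ∀ ⦃A A' B B' : Set V⦄, A ⊆ A' → B' ⊆ B → Gp A - Gm B ≤ Gp A' - Gm B' :=
    fun A A' B B' hA hB => sub_le_sub (hGp hA) (hGm hB)
  have hso₁ : ∀ A B : Set V, 0 ≤ (Fp A - Fm B) + (Fp B - Fm A) := fun A B => by linarith [hF A, hF B]
  have hso₂ : ∀ A B : Set V, 0 ≤ (Gp A - Gm B) + (Gp B - Gm A) := fun A B => by linarith [hG A, hG B]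
  exact top_sum_nonneg E s P hsP hsPE htwin hTA (K₁ := fun A B => Fp A - Fm B) (K₂ := fun A B => Gp A - Gm B) hK₁ hso₁ hK₂ hso₂

/-- **THEOREM TA (the |R| = 1 vertex antithetic inequality at a twin of the source).**  Let `s ≠ P` be non-adjacent twins
(`N(s) ∖ {P} = N(P) ∖ {s}`, `sP ∉ E`) such that every vertex outside `N(s) ∪ {s, P}` is adjacent to every common neighbour of `s` and `P`.
Then for all monotone `F, G`:  `0 ≤ Σ_{T : ¬(P ∈ X T ∧ P ∈ Y T)} (F(X T) − F(Y T))·(G(X T) − G(Y T))`.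
Covers: both apexes of the suspension of any finite graph (e.g. the octahedron at the antipode, `K_{2,k}` plus any pairs among the middle
vertices), `K_{m,n}` at a vertex on the source's side, every complete multipartite graph at a vertex of the source's part, every join of an
independent set with an arbitrary graph. [this work] -/
theorem vertex_sum_nonneg (E : Set (Sym2 V)) (s P : V) (hsP : s ≠ P) (hsPE : s(s, P) ∉ E)
    (htwin : ∀ v, v ≠ s → v ≠ P → (s(s, v) ∈ E ↔ s(P, v) ∈ E))
    (hTA : ∀ w v, w ≠ s → w ≠ P → s(s, w) ∉ E → v ≠ s → v ≠ P → s(s, v) ∈ E → s(w, v) ∈ E)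
    {F G : Set V → ℝ} (hF : Monotone F) (hG : Monotone G) :
    0 ≤ ∑ T ∈ Finset.univ.filter (fun T : Set (Sym2 V) =>
        ¬ ((openGraph (T ∩ E)).Reachable s P ∧ (openGraph (Tᶜ ∩ E)).Reachable s P)),
      (F (openCluster (T ∩ E) s) - F (openCluster (Tᶜ ∩ E) s)) * (G (openCluster (T ∩ E) s) - G (openCluster (Tᶜ ∩ E) s)) :=
  TopVertex.vertex_sum_nonneg_of_top E s P (fun F' G' hF' hG' =>
    top_shift_sum_nonneg E s P hsP hsPE htwin hTA F' F' G' G' hF' hF' (fun _ => le_rfl) hG' hG' (fun _ => le_rfl)) hF hG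

end Twin

end Antithetic

end Summit.CriticalPhenomena.PercolationContinuityZ3.Theorems
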